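import Summits.KontsevichZagierPeriods.KontsevichZagierPeriods.Theorems.RootDecompRelativeModAbsoluteCylLogSplitP08

/-! # `RootDecompRelativeModAbsoluteCylLogSplitP09` — part 9/25 of the mechanical ≤330-line split of `CylLogSplit.lean`
(split by the decomp-kz census seat for landing; mathematics unchanged; part 9 continues part 8). -/

noncomputable section
open Set MeasureTheory Filter Topology
open scoped BigOperators
open Literature.NumberTheory.Transcendental Literature.ModelTheory.ExponentialFields

namespace Summit.KontsevichZagierPeriods.RootDecompRelativeModAbsolute.Rung30571

namespace RegularisedLogLayer

namespace CylLog
variable {b : ℕ}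

/-- **Affine substitution along the last coordinate, decreasing case `β < 0`.**
[Kontsevich–Zagier 2001, §1.2, rule 2)] [folklore] -/
theorem of_sub_of_mem_relations_of_affine_neg {m : ℕ} {G : Set (Fin m → ℝ)} (hGo : IsOpen G)
    {α β a b a' b' : (Fin m → ℝ) → ℝ}
    (hα : IsSemialgebraicFunOn ℚ G α) (hβ : IsSemialgebraicFunOn ℚ G β)
    (hαd : DifferentiableOn ℝ α G) (hβd : DifferentiableOn ℝ β G) (hβneg : ∀ y ∈ G, β y < 0)
    (r r' : KZ.IntegralRep (m + 1)) (hr : r.domain = KZlog.band G a b)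
    (hr' : r'.domain = KZlog.band G a' b')
    (ha' : ∀ y ∈ G, a' y = α y + β y * b y) (hb' : ∀ y ∈ G, b' y = α y + β y * a y)
    (hint : ∀ z ∈ r.domain, r.integrand z =
      r'.integrand (Fin.snoc (Fin.init z) (α (Fin.init z) + β (Fin.init z) * z (Fin.last m))) *
        (-β (Fin.init z))) :
    KZ.of r - KZ.of r' ∈ KZ.relations := by
  have hmemG : ∀ z ∈ r.domain, Fin.init z ∈ G := fun z hz => by
    rw [hr] at hz
    exact hz.1
  have hαd' : ∀ y ∈ G, HasFDerivAt α (fderiv ℝ α y) y := fun y hy =>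
    ((hαd y hy).differentiableAt (hGo.mem_nhds hy)).hasFDerivAt
  have hβd' : ∀ y ∈ G, HasFDerivAt β (fderiv ℝ β y) y := fun y hy =>
    ((hβd y hy).differentiableAt (hGo.mem_nhds hy)).hasFDerivAt
  -- the substitution
  set Φ : (Fin (m + 1) → ℝ) → (Fin (m + 1) → ℝ) := fun z =>
    Fin.snoc (Fin.init z) (α (Fin.init z) + β (Fin.init z) * z (Fin.last m)) with hΦ
  -- continuous linear pieces
  let initL : (Fin (m + 1) → ℝ) →L[ℝ] (Fin m → ℝ) :=
    ContinuousLinearMap.pi fun i => ContinuousLinearMap.proj (Fin.castSucc i)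
  let lastL : (Fin (m + 1) → ℝ) →L[ℝ] ℝ := ContinuousLinearMap.proj (Fin.last m)
  have hinitL : ∀ w, initL w = Fin.init w := fun w => rfl
  have hlastL : ∀ w, lastL w = w (Fin.last m) := fun w => rfl
  let row : (Fin (m + 1) → ℝ) → (Fin (m + 1) → ℝ) →L[ℝ] ℝ := fun z =>
    (fderiv ℝ α (Fin.init z)).comp initL +
      z (Fin.last m) • (fderiv ℝ β (Fin.init z)).comp initL + β (Fin.init z) • lastL
  have hrow : ∀ z w, row z w = fderiv ℝ α (Fin.init z) (Fin.init w) +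
      z (Fin.last m) * fderiv ℝ β (Fin.init z) (Fin.init w) + β (Fin.init z) * w (Fin.last m) := by
    intro z w
    simp [row, hinitL, hlastL]
  let Φ' : (Fin (m + 1) → ℝ) → (Fin (m + 1) → ℝ) →L[ℝ] (Fin (m + 1) → ℝ) := fun z =>
    ContinuousLinearMap.pi
      (Fin.lastCases (motive := fun _ => (Fin (m + 1) → ℝ) →L[ℝ] ℝ) (row z)
        (fun i => ContinuousLinearMap.proj (Fin.castSucc i)))
  have hΦ' : ∀ z w, Φ' z w = Fin.snoc (Fin.init w) (row z w) := by
    intro z w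
    funext i
    refine Fin.lastCases ?_ (fun j => ?_) i
    · simp [Φ']
    · simp [Φ', Fin.init]
  -- determinant
  have hdet : ∀ z, (Φ' z).det = β (Fin.init z) := by
    intro z
    have h := LinearMap.det_of_snoc_init (Φ' z : (Fin (m + 1) → ℝ) →ₗ[ℝ] (Fin (m + 1) → ℝ))
      LinearMap.id
      (((fderiv ℝ α (Fin.init z) : (Fin m → ℝ) →L[ℝ] ℝ) +
        z (Fin.last m) • (fderiv ℝ β (Fin.init z))) : (Fin m → ℝ) →ₗ[ℝ] ℝ)
      (β (Fin.init z)) (fun w => by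
        rw [ContinuousLinearMap.coe_coe, hΦ', hrow]
        simp)
    rw [LinearMap.det_id, mul_one] at h
    exact h
  -- derivative
  have hderiv : ∀ z : Fin (m + 1) → ℝ, Fin.init z ∈ G → HasFDerivAt Φ (Φ' z) z := by
    intro z hz
    rw [hasFDerivAt_pi']
    intro i
    refine Fin.lastCases ?_ (fun j => ?_) i
    · have h1 : HasFDerivAt (fun x : Fin (m + 1) → ℝ => Fin.init x) initL z := initL.hasFDerivAt
      have hαc := (hαd' _ hz).comp z h1
      have hβc := (hβd' _ hz).comp z h1
      have hl : HasFDerivAt (fun x : Fin (m + 1) → ℝ => x (Fin.last m)) lastL z :=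
        hasFDerivAt_apply (Fin.last m) z
      have h := hαc.add (hβc.mul hl)
      have hfun : (fun x => Φ x (Fin.last m)) =
          fun x => (α ∘ fun x : Fin (m + 1) → ℝ => Fin.init x) x +
            (β ∘ fun x : Fin (m + 1) → ℝ => Fin.init x) x * x (Fin.last m) := by
        funext x
        simp [hΦ]
      show HasFDerivAt (fun x => Φ x (Fin.last m)) _ z
      rw [hfun]
      refine h.congr_fderiv (ContinuousLinearMap.ext fun w => ?_)
      simp only [ContinuousLinearMap.coe_comp, Function.comp_apply, hΦ', hrow]
      simp [hinitL, hlastL]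
      ring
    · have hfun : (fun x => Φ x (Fin.castSucc j)) = fun x => x (Fin.castSucc j) := by
        funext x
        simp [hΦ, Fin.init]
      show HasFDerivAt (fun x => Φ x (Fin.castSucc j)) _ z
      rw [hfun]
      refine (hasFDerivAt_apply (Fin.castSucc j) z).congr_fderiv
        (ContinuousLinearMap.ext fun w => ?_)
      simp [hΦ', Fin.init]
  -- semialgebraicity of the pieces on the band
  have hαi : IsSemialgebraicFunOn ℚ r.domain (fun z => α (Fin.init z)) :=
    hα.comp_init_mono r.isSemialgebraic_domain hmemG
  have hβi : IsSemialgebraicFunOn ℚ r.domain (fun z => β (Fin.init z)) :=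
    hβ.comp_init_mono r.isSemialgebraic_domain hmemG
  have hli := isSemialgebraicFunOn_apply r.isSemialgebraic_domain (Fin.last _)
  refine KZ.changeOfVariablesRel_subset_relations ⟨m + 1, r, r', Φ, Φ', ?_, ?_, ?_, ?_, ?_, rfl⟩
  · -- semialgebraic map
    refine (isSemialgebraicMapOn_iff_forall_holds r.isSemialgebraic_domain).mpr fun i => ?_
    refine Fin.lastCases ?_ (fun j => ?_) i
    · exact (IsSemialgebraicFunOn.add_holds hαi (IsSemialgebraicFunOn.mul_holds hβi hli)).congr
        fun z _ => by simp [hΦ]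
    · exact (isSemialgebraicFunOn_aeval r.isSemialgebraic_domain
        (MvPolynomial.X (Fin.castSucc j))).congr fun z _ => by simp [hΦ, Fin.init]
  · exact fun z hz => (hderiv z (hmemG z hz)).hasFDerivWithinAt
  · intro z₁ hz₁ z₂ hz₂ h
    have hy : Fin.init z₁ = Fin.init z₂ := by
      have := congrArg Fin.init h
      simpa [hΦ] using this
    have hl : α (Fin.init z₁) + β (Fin.init z₁) * z₁ (Fin.last m) =
        α (Fin.init z₂) + β (Fin.init z₂) * z₂ (Fin.last m) := by
      have := congrFun h (Fin.last m)
      simpa [hΦ] using this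
    rw [hy] at hl
    have hs : z₁ (Fin.last m) = z₂ (Fin.last m) :=
      mul_left_cancel₀ (hβneg _ (hmemG z₂ hz₂)).ne (add_left_cancel hl)
    rw [← Fin.snoc_init_self z₁, ← Fin.snoc_init_self z₂, hy, hs]
  · rw [hr']
    ext w
    simp only [mem_image]
    constructor
    · intro hw
      have hy : Fin.init w ∈ G := hw.1
      have hβy := hβneg _ hy
      refine ⟨Fin.snoc (Fin.init w) ((w (Fin.last m) - α (Fin.init w)) / β (Fin.init w)), ?_, ?_⟩
      · rw [hr]
        refine ⟨by simpa using hy, ?_, ?_⟩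
        · simp only [Fin.init_snoc, Fin.snoc_last]
          rw [le_div_iff_of_neg hβy]
          have := hw.2.2
          rw [hb' _ hy] at this
          linarith
        · simp only [Fin.init_snoc, Fin.snoc_last]
          rw [div_le_iff_of_neg hβy]
          have := hw.2.1
          rw [ha' _ hy] at this
          linarith
      · simp only [hΦ, Fin.init_snoc, Fin.snoc_last]
        rw [mul_div_cancel₀ _ hβy.ne, add_sub_cancel, Fin.snoc_init_self]
    · rintro ⟨z, hz, rfl⟩
      have hy : Fin.init z ∈ G := hmemG z hz
      rw [hr] at hz
      have hβy := hβneg _ hy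
      refine ⟨by simpa [hΦ] using hy, ?_, ?_⟩
      · simp only [hΦ, Fin.init_snoc, Fin.snoc_last]
        rw [ha' _ hy]
        have := hz.2.2
        nlinarith
      · simp only [hΦ, Fin.init_snoc, Fin.snoc_last]
        rw [hb' _ hy]
        have := hz.2.1
        nlinarith
  · intro z hz
    rw [hint z hz, hdet, abs_of_neg (hβneg _ (hmemG z hz))]

/-- **Cylinder → regularised cell (glue D3), `−1 < κ < 0`.**  Over an open base with `κ` differentiable,
`−1 < κ < 0`, the cylinder cell `[{0≤θ≤1} over G, c θ^M/(1+θκ)]` and the REVERSED regularised cell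
`[{1+κ ≤ t ≤ 1}, (−c/κ^{M+1}) (t−1)^M/t]` differ by a relation (rule 2 along the decreasing affine map
`t = 1 + κθ`: `θ^M/(1+θκ) = ((t−1)^M/(κ^M t))` and `|dt/dθ| = −κ`).  Consistently with the oriented
convention `P(W) = −[reversed band]` for `W = 1 + κ < 1`, the oriented cell is `P_M(c/κ^{M+1}, 1+κ)`. -/
theorem cyl_sub_regNeg_mem_relations {b M : ℕ} {G : Set (Fin b → ℝ)} {c κ : (Fin b → ℝ) → ℝ}
    (hGo : IsOpen G) (hG : IsSemialgebraic ℚ G) (hκ : IsSemialgebraicFunOn ℚ G κ)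
    (hκd : DifferentiableOn ℝ κ G) (hκ0 : ∀ x ∈ G, κ x < 0) (hκ1 : ∀ x ∈ G, -1 < κ x)
    (Cy Rg : KZ.IntegralRep (b + 1)) (hCd : Cy.domain = KZlog.band G (fun _ => 0) (fun _ => 1))
    (hCi : EqOn Cy.integrand (fun z => c (Fin.init z) *
      (z (Fin.last b) ^ M / (1 + z (Fin.last b) * κ (Fin.init z)))) Cy.domain)
    (hRd : Rg.domain = KZlog.band G (fun x => 1 + κ x) (fun _ => 1))
    (hRi : EqOn Rg.integrand (fun z => -(c (Fin.init z) / κ (Fin.init z) ^ (M + 1)) *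
      ((z (Fin.last b) - 1) ^ M / z (Fin.last b))) Rg.domain) :
    KZ.of Cy - KZ.of Rg ∈ KZ.relations := by
  refine of_sub_of_mem_relations_of_affine_neg hGo (α := fun _ => 1) (β := κ)
    (by simpa using isSemialgebraicFunOn_ratCast hG 1) hκ (differentiableOn_const _) hκd hκ0 Cy Rg
    hCd hRd (fun y _ => by ring) (fun y _ => by ring) fun z hz => ?_
  have hz' : z ∈ KZlog.band G (fun _ => 0) (fun _ => 1) := hCd ▸ hz
  obtain ⟨hx, h0, h1⟩ := hz'
  have hk : κ (Fin.init z) < 0 := hκ0 _ hx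
  have hk1 : -1 < κ (Fin.init z) := hκ1 _ hx
  have hpos : 0 < 1 + κ (Fin.init z) * z (Fin.last b) := by
    have : κ (Fin.init z) ≤ κ (Fin.init z) * z (Fin.last b) := by nlinarith
    linarith
  have hmem : (Fin.snoc (Fin.init z) (1 + κ (Fin.init z) * z (Fin.last b)) : Fin (b + 1) → ℝ) ∈
      Rg.domain := by
    rw [hRd, KZlog.snoc_mem_band]
    refine ⟨hx, ?_, ?_⟩
    · have h := le_mul_of_le_one_right hk.le h1
      simpa using h
    · have h : κ (Fin.init z) * z (Fin.last b) ≤ 0 := by nlinarith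
      simpa using h
  rw [hCi hz, hRi hmem]
  simp only [Fin.init_snoc, Fin.snoc_last, add_sub_cancel_left]
  have hk0 : κ (Fin.init z) ≠ 0 := hk.ne
  have hp0 : 1 + z (Fin.last b) * κ (Fin.init z) ≠ 0 := by rw [mul_comm]; exact hpos.ne'
  have hp0' : 1 + κ (Fin.init z) * z (Fin.last b) ≠ 0 := hpos.ne'
  field_simp
  ring

/-! ### §3j Open cell → closed band (glue D3′) — PROVED

The root node's cylinders are OPEN `θ`-cells `{x ∈ P, θ ∈ (0,1)}`; the regularised calculus above is written on
closed bands.  The passage is the a.e.-congruence move (landed `AECongr`, unconditional): the two graphs are null. -/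

end CylLog
end RegularisedLogLayer
end Summit.KontsevichZagierPeriods.RootDecompRelativeModAbsolute.Rung30571
end
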